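import Mathlib
import HarnessLib
import Literature.MathematicalPhysics.QuantumLattice.SectorisedCrossContractionBound
import Summits.HubbardSuperconductivity.HubbardSuperconductivity.Theorems.KLProgrammeKLRegimeWickTwoCopyKernel

/-!
# Route `KLProgramme` — ENGINE child (stmt-HubbardSuperconductivity-19918), `stub_engine_step_values` (E2-v9), E2-WICK-ROADMAP §5 (iv):
# the `k + 1`-line two-vertex term in the sectorised `L¹–L^∞` norm — Grassmann side GLUED to the size-function bound

Cell gate-hubbard-kl, seat p5 (g4).  Sequel of …WickTwoCopyKernel (`norm_kernel_crossContract_le`: the kernel of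
`(Δ_×(C_k)∘⋯∘Δ_×(C_0))(a⁰·b¹)` at a doubled output tuple is bounded by the size function `Σ_{X,Y} (∏_i ‖A_{C_i}(X_i,Y_i)‖)·‖a‖·‖b‖` once the
tuple is sorted by copy) and of `Literature/…/SectorisedCrossContractionBound.sum_crossContraction_le` (FKT Part 3 Prop. XII «three
contractions»: that size function, summed over the free legs with one leg pinned, costs `c·∏(d_i r_i)·Na·Nb`).  Here the two are put together:

* `exists_colouring_equiv` — SORTING BY COLOUR, uniformly in the tuple: for a colouring `s : Fin m → Fin 2` with `m₀` zeros and `m₁` ones there are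
  ONE permutation `σ` and ONE splitting `ε : Fin m₀ ⊕ Fin m₁ ≃ Fin m` such that EVERY doubled tuple `(Z, s)` is sorted by `σ` into the block form
  `append (Z∘ε∘inr, 1) (Z∘ε∘inl, 0)` of `norm_kernel_crossContract_le`; `sum_comp_sumEquiv`, `sum_filter_comp_sumEquiv_inl/_inr` — the induced
  re-indexing `Σ_Z f(Z∘ε∘inl, Z∘ε∘inr) = Σ_{X₀} Σ_{Y₁} f(X₀,Y₁)`, also with a pinned leg;
* `norm_contr_le`, `sum_norm_contr_le`, `sum_norm_contr_le'`, `norm_contr_le_of_entry` — adapters from entry / row / column bounds of a covariance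
  `C` to its two-point function `A_C = ½(Cᵀ − C)` (`GrassmannLaplacianPairWick.contr`), the line kernel produced by the cross Laplacian;
* **`sum_norm_kernel_crossContract_le`** (pinned leg in copy `0`, i.e. a free leg of `a`) and **`sum_norm_kernel_crossContract_le_of_eq_one`**
  (pinned leg in copy `1`): for `k + 1` covariances `C_0, …, C_k` on sector-field labels `P × S` with line `0` in `L¹` (`Σ_Y ‖A_{C_0}(X,Y)‖ ≤ c`),
  lines `i ≥ 1` sector-diagonal in sup norm (`‖A_{C_i}(X,Y)‖ ≤ d_i·D_i(σ_X,σ_Y)`, `Σ_τ D_i(σ,τ) ≤ r_i`), `a` of size `Na` in the norm pinned at a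
  free leg (its `k + 1` contracted legs summed), `b` of size `Nb` with its line-`0` leg AND the sectors of its other `k` contracted legs fixed:
  `Σ_{Z : Z p = z} ‖kernel ((Δ_×(C_k)∘⋯∘Δ_×(C_0))(a⁰·b¹)) m (Z, s)‖ ≤ ((k+1+m₀)!(k+1+m₁)!/m!) · c · ∏_i (d_i r_i) · Na · Nb`;
* `sum_norm_kernel_dblFold_le` — summing the colourings bounds the folded (physical) kernel.

Pure bookkeeping over the two landed files; no definitions, no named facts, nothing about the model.  References (locators only):
Feldman–Knörrer–Trubowitz, Rev. Math. Phys. 15 (2003) 1121–1169, Prop. XII and «three contractions»; Benfatto–Giuliani–Mastropietro,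
Ann. Henri Poincaré 7 (2006) §2.8 (2.76)–(2.83).
-/

noncomputable section

namespace Summit.HubbardSuperconductivity.HubbardSuperconductivity.Theorems.KLRegimeWick

set_option linter.dupNamespace false -- summit = problem name (single-conjunct summit), D-0017

open Literature.MathematicalPhysics.QuantumLattice GrassmannAlgebra Finset Matrix

/-! ## §1 Sorting a doubled tuple by colour, uniformly in the tuple -/

section Sorting

variable {Γ : Type*}

/-- **Sorting by colour.**  For a colouring `s : Fin m → Fin 2` with `m₀` zeros and `m₁` ones there are a permutation `σ` of `Fin (m₁ + m₀)` and a
splitting `ε : Fin m₀ ⊕ Fin m₁ ≃ Fin m` onto the zeros (`inl`) and the ones (`inr`) such that every doubled tuple `(Z i, s i)_i` is sorted by `σ`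
into the block form `append (Z∘ε∘inr, 1) (Z∘ε∘inl, 0)` (copy `1` first) used by `norm_kernel_crossContract_le`. -/
theorem exists_colouring_equiv {m m₀ m₁ : ℕ} (s : Fin m → Fin 2) (hm₀ : (univ.filter fun i => s i = 0).card = m₀)
    (hm₁ : (univ.filter fun i => s i = 1).card = m₁) :
    ∃ (h : m = m₁ + m₀) (σ : Equiv.Perm (Fin (m₁ + m₀))) (ε : Fin m₀ ⊕ Fin m₁ ≃ Fin m),
      (∀ j, s (ε (Sum.inl j)) = 0) ∧ (∀ j, s (ε (Sum.inr j)) = 1) ∧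
        ∀ Z : Fin m → Γ, ((fun i => (Z i, s i)) ∘ Fin.cast h.symm) ∘ σ =
          Fin.append (fun j => (Z (ε (Sum.inr j)), (1 : Fin 2))) (fun j => (Z (ε (Sum.inl j)), (0 : Fin 2))) := by
  classical
  set p : Fin m → Prop := fun i => s i = 1 with hp
  have h1 : Fintype.card {i // p i} = m₁ := by rw [Fintype.card_subtype, ← hm₁]
  have h0 : Fintype.card {i // ¬p i} = m₀ := by
    rw [Fintype.card_subtype, ← hm₀]
    congr 1
    ext i
    simp only [mem_filter, mem_univ, true_and, hp]
    constructor <;> intro h <;> omega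
  have hcard : m = m₁ + m₀ := by
    have := Fintype.card_subtype_compl p
    rw [h0, h1, Fintype.card_fin] at this
    have hle : m₁ ≤ m := by rw [← h1]; exact (Fintype.card_subtype_le _).trans (Fintype.card_fin m).le
    omega
  set e₁ : Fin m₁ ≃ {i // p i} := (Fintype.equivFinOfCardEq h1).symm with he₁
  set e₀ : Fin m₀ ≃ {i // ¬p i} := (Fintype.equivFinOfCardEq h0).symm with he₀
  set τ : Fin (m₁ + m₀) ≃ Fin m := finSumFinEquiv.symm.trans ((e₁.sumCongr e₀).trans (Equiv.sumCompl p)) with hτ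
  set ε : Fin m₀ ⊕ Fin m₁ ≃ Fin m := ((e₀.sumCongr e₁).trans (Equiv.sumComm _ _)).trans (Equiv.sumCompl p) with hε
  have hεl : ∀ j, ε (Sum.inl j) = (e₀ j : Fin m) := fun j => by simp [hε, Equiv.sumCompl_apply_inr]
  have hεr : ∀ j, ε (Sum.inr j) = (e₁ j : Fin m) := fun j => by simp [hε, Equiv.sumCompl_apply_inl]
  refine ⟨hcard, τ.trans (finCongr hcard), ε, fun j => ?_, fun j => ?_, fun Z => ?_⟩
  · rw [hεl]
    have hne : ¬ s (e₀ j : Fin m) = 1 := (e₀ j).2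
    omega
  · rw [hεr]; exact (e₁ j).2
  funext i
  have hcc : ∀ x : Fin m, Fin.cast hcard.symm (Fin.cast hcard x) = x := fun x => Fin.ext rfl
  simp only [Function.comp_apply, Equiv.trans_apply, finCongr_apply, hcc]
  refine Fin.addCases (fun j => ?_) (fun j => ?_) i
  · have hτj : τ (Fin.castAdd m₀ j) = (e₁ j : Fin m) := by
      simp [hτ, finSumFinEquiv_symm_apply_castAdd, Equiv.sumCompl_apply_inl]
    rw [hτj, Fin.append_left, hεr]
    exact Prod.ext rfl (e₁ j).2
  · have hτj : τ (Fin.natAdd m₁ j) = (e₀ j : Fin m) := by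
      simp [hτ, finSumFinEquiv_symm_apply_natAdd, Equiv.sumCompl_apply_inr]
    rw [hτj, Fin.append_right, hεl]
    have hne : ¬ s (e₀ j : Fin m) = 1 := (e₀ j).2
    exact Prod.ext rfl (by simp only; omega)

variable [Fintype Γ]

/-- Re-indexing a sum over tuples by a splitting `ε : Fin m₀ ⊕ Fin m₁ ≃ Fin m`: `Σ_Z f(Z∘ε∘inl, Z∘ε∘inr) = Σ_{X₀} Σ_{Y₁} f(X₀, Y₁)`. -/
theorem sum_comp_sumEquiv {M : Type*} [AddCommMonoid M] {m m₀ m₁ : ℕ} (ε : Fin m₀ ⊕ Fin m₁ ≃ Fin m)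
    (f : (Fin m₀ → Γ) → (Fin m₁ → Γ) → M) :
    ∑ Z : Fin m → Γ, f (fun j => Z (ε (Sum.inl j))) (fun j => Z (ε (Sum.inr j))) =
      ∑ X₀ : Fin m₀ → Γ, ∑ Y₁ : Fin m₁ → Γ, f X₀ Y₁ := by
  rw [← Fintype.sum_prod_type']
  refine Fintype.sum_equiv (((ε.symm.arrowCongr (Equiv.refl Γ))).trans (Equiv.sumArrowEquivProdArrow _ _ _)) _ _ fun Z => ?_
  rfl

/-- `sum_comp_sumEquiv` with a leg pinned among the zeros: `Σ_{Z : Z(ε(inl p₀)) = z} f = Σ_{X₀ : X₀ p₀ = z} Σ_{Y₁} f(X₀,Y₁)`. -/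
theorem sum_filter_comp_sumEquiv_inl {m m₀ m₁ : ℕ} [DecidableEq Γ] (ε : Fin m₀ ⊕ Fin m₁ ≃ Fin m)
    (f : (Fin m₀ → Γ) → (Fin m₁ → Γ) → ℝ) (p₀ : Fin m₀) (z : Γ) :
    ∑ Z ∈ univ.filter (fun Z : Fin m → Γ => Z (ε (Sum.inl p₀)) = z), f (fun j => Z (ε (Sum.inl j))) (fun j => Z (ε (Sum.inr j))) =
      ∑ X₀ ∈ univ.filter (fun X₀ : Fin m₀ → Γ => X₀ p₀ = z), ∑ Y₁ : Fin m₁ → Γ, f X₀ Y₁ := by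
  rw [sum_filter, sum_filter]
  rw [sum_comp_sumEquiv ε fun X₀ Y₁ => if X₀ p₀ = z then f X₀ Y₁ else 0]
  refine sum_congr rfl fun X₀ _ => ?_
  split_ifs <;> simp

/-- `sum_comp_sumEquiv` with a leg pinned among the ones: `Σ_{Z : Z(ε(inr p₁)) = z} f = Σ_{Y₁ : Y₁ p₁ = z} Σ_{X₀} f(X₀,Y₁)`. -/
theorem sum_filter_comp_sumEquiv_inr {m m₀ m₁ : ℕ} [DecidableEq Γ] (ε : Fin m₀ ⊕ Fin m₁ ≃ Fin m)
    (f : (Fin m₀ → Γ) → (Fin m₁ → Γ) → ℝ) (p₁ : Fin m₁) (z : Γ) :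
    ∑ Z ∈ univ.filter (fun Z : Fin m → Γ => Z (ε (Sum.inr p₁)) = z), f (fun j => Z (ε (Sum.inl j))) (fun j => Z (ε (Sum.inr j))) =
      ∑ Y₁ ∈ univ.filter (fun Y₁ : Fin m₁ → Γ => Y₁ p₁ = z), ∑ X₀ : Fin m₀ → Γ, f X₀ Y₁ := by
  rw [sum_filter, sum_filter]
  rw [sum_comp_sumEquiv ε fun X₀ Y₁ => if Y₁ p₁ = z then f X₀ Y₁ else 0, sum_comm]
  refine sum_congr rfl fun Y₁ _ => ?_
  split_ifs <;> simp

end Sorting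

/-! ## §2 From covariance bounds to two-point-function bounds -/

section Contr

variable {𝕜 : Type*} [RCLike 𝕜] {Γ : Type*}

/-- `‖A_C(X,Y)‖ ≤ (‖C(Y,X)‖ + ‖C(X,Y)‖)/2` for the two-point function `A_C = ½(Cᵀ − C)`. -/
theorem norm_contr_le (C : Matrix Γ Γ 𝕜) (X Y : Γ) : ‖contr 𝕜 C X Y‖ ≤ (‖C Y X‖ + ‖C X Y‖) / 2 := by
  rw [contr_apply, norm_mul]
  have h2 : ‖((1 / 2 : ℚ) • (1 : 𝕜))‖ = 1 / 2 := by
    rw [Rat.smul_one_eq_cast]; simp [norm_inv]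
  rw [h2]
  have := norm_sub_le (C Y X) (C X Y)
  linarith

/-- The two-point function has symmetric modulus: `‖A_C(Y,X)‖ = ‖A_C(X,Y)‖`. -/
theorem norm_contr_swap (C : Matrix Γ Γ 𝕜) (X Y : Γ) : ‖contr 𝕜 C Y X‖ = ‖contr 𝕜 C X Y‖ := by
  rw [contr_swap, norm_neg]

variable [Fintype Γ]

/-- Row sums of `‖A_C‖` from row AND column sums of `‖C‖`: `Σ_Y ‖C X Y‖ ≤ α`, `Σ_Y ‖C Y X‖ ≤ α` ⇒ `Σ_Y ‖A_C(X,Y)‖ ≤ α`. -/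
theorem sum_norm_contr_le (C : Matrix Γ Γ 𝕜) {α : ℝ} (hrow : ∀ X, ∑ Y, ‖C X Y‖ ≤ α) (hcol : ∀ X, ∑ Y, ‖C Y X‖ ≤ α) (X : Γ) :
    ∑ Y, ‖contr 𝕜 C X Y‖ ≤ α := by
  calc ∑ Y, ‖contr 𝕜 C X Y‖ ≤ ∑ Y, (‖C Y X‖ + ‖C X Y‖) / 2 := sum_le_sum fun Y _ => norm_contr_le C X Y
    _ = ((∑ Y, ‖C Y X‖) + ∑ Y, ‖C X Y‖) / 2 := by rw [← sum_add_distrib, sum_div]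
    _ ≤ (α + α) / 2 := by gcongr <;> simp [hcol X, hrow X]
    _ = α := by ring

/-- Column sums of `‖A_C‖` equal row sums (antisymmetry): the same bound. -/
theorem sum_norm_contr_le' (C : Matrix Γ Γ 𝕜) {α : ℝ} (hrow : ∀ X, ∑ Y, ‖C X Y‖ ≤ α) (hcol : ∀ X, ∑ Y, ‖C Y X‖ ≤ α) (Y : Γ) :
    ∑ X, ‖contr 𝕜 C X Y‖ ≤ α := by
  simp_rw [norm_contr_swap C Y]
  exact sum_norm_contr_le C hrow hcol Y

omit [Fintype Γ] in
/-- Entry bound of `‖A_C‖` between sector fields from a sector-diagonal entry bound of `C`: if `‖C(X,Y)‖ ≤ δ·E(σ_X,σ_Y)` with `E` symmetric then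
`‖A_C(X,Y)‖ ≤ δ·E(σ_X,σ_Y)`. -/
theorem norm_contr_le_of_entry {P S : Type*} (C : Matrix (P × S) (P × S) 𝕜) {δ : ℝ} (E : S → S → ℝ) (hE : ∀ σ τ, E σ τ = E τ σ)
    (hC : ∀ X Y, ‖C X Y‖ ≤ δ * E X.2 Y.2) (X Y : P × S) : ‖contr 𝕜 C X Y‖ ≤ δ * E X.2 Y.2 := by
  have h1 := hC Y X
  rw [hE] at h1
  have := norm_contr_le C X Y
  linarith [hC X Y]

end Contr

/-! ## §3 The glued bound -/

section Glue

variable {𝕜 : Type*} [RCLike 𝕜] {P S : Type*} [Fintype P] [Fintype S] [DecidableEq P] [DecidableEq S]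

/-- **The `k + 1`-line two-vertex term in the sectorised `L¹–L^∞` norm, pinned at a free leg of `a`** (FKT Part 3, Prop. XII «three
contractions», on the tree's Grassmann carriers).  Lines: `C_0` in `L¹` through the row sums of its two-point function, `C_1, …, C_k` sector-diagonal
in sup norm; `a` in the norm pinned at a free leg with its `k + 1` contracted legs summed (`Na`, any pinned position); `b` with the label of its
line-`0` leg and the SECTORS of its other `k` contracted legs fixed (`Nb`).  For every colouring `s` of the `m` output legs with `m₀` legs from `a`
and `m₁` from `b`, and every pinned output leg `p` of colour `0`:
`Σ_{Z : Z p = z} ‖kernel ((Δ_×(C_k)∘⋯∘Δ_×(C_0))(a⁰·b¹)) m (Z, s)‖ ≤ ((k+1+m₀)!·(k+1+m₁)!/m!) · (c · ∏_i (d_i r_i) · Na · Nb)`. -/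
theorem sum_norm_kernel_crossContract_le {k m m₀ m₁ : ℕ} (C : Fin (k + 1) → Matrix (P × S) (P × S) 𝕜)
    (a b : GrassmannAlgebra 𝕜 (P × S)) (s : Fin m → Fin 2) (hm₀ : (univ.filter fun i => s i = 0).card = m₀)
    (hm₁ : (univ.filter fun i => s i = 1).card = m₁) (p : Fin m) (hp : s p = 0) (z : P × S)
    {c : ℝ} (hc : ∀ X, ∑ Y, ‖contr 𝕜 (C 0) X Y‖ ≤ c)
    (D : Fin k → S → S → ℝ) (hD : ∀ i σ τ, 0 ≤ D i σ τ) (d r : Fin k → ℝ) (hd : ∀ i, 0 ≤ d i)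
    (hLD : ∀ (i : Fin k) (X Y : P × S), ‖contr 𝕜 (C i.succ) X Y‖ ≤ d i * D i X.2 Y.2) (hr : ∀ i σ, ∑ τ, D i σ τ ≤ r i)
    {Na Nb : ℝ} (hNb0 : 0 ≤ Nb)
    (hNa : ∀ p₀ : Fin m₀, ∑ X : Fin (k + 1) → P × S, ∑ X₀ ∈ univ.filter (fun X₀ : Fin m₀ → P × S => X₀ p₀ = z),
      ‖kernel 𝕜 a (k + 1 + m₀) (Fin.append X X₀)‖ ≤ Na)
    (hNb : ∀ (Y₀ : P × S) (τ : Fin k → S), ∑ y : Fin k → P, ∑ Y₁ : Fin m₁ → P × S,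
      ‖kernel 𝕜 b (k + 1 + m₁) (Fin.append (Fin.cons Y₀ (fun i => (y i, τ i)) : Fin (k + 1) → P × S) Y₁)‖ ≤ Nb) :
    ∑ Z ∈ univ.filter (fun Z : Fin m → P × S => Z p = z),
        ‖kernel 𝕜 (((List.ofFn fun i => grassmannLaplacian 𝕜 (crossCov 𝕜 (C i))).reverse).prod
          (dblCopy 𝕜 0 a * dblCopy 𝕜 1 b)) m (fun i => (Z i, s i))‖ ≤
      (((k + 1 + m₀).factorial * (k + 1 + m₁).factorial : ℝ) / m.factorial) * (c * (∏ i, d i * r i) * Na * Nb) := by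
  classical
  obtain ⟨h, σ, ε, h0, h1, hZ⟩ := exists_colouring_equiv (Γ := P × S) s hm₀ hm₁
  -- the pinned leg is a zero of the colouring: `p = ε (inl p₀)`
  obtain ⟨p₀, hp₀⟩ : ∃ p₀ : Fin m₀, ε (Sum.inl p₀) = p := by
    rcases hq : ε.symm p with p₀ | j
    · exact ⟨p₀, by rw [← hq, Equiv.apply_symm_apply]⟩
    · exfalso
      have := h1 j
      rw [← hq, Equiv.apply_symm_apply, hp] at this
      exact absurd this (by decide)
  subst hp₀
  -- size functions
  set Ka : (Fin (k + 1) → P × S) → (Fin m₀ → P × S) → ℝ := fun X X₀ => ‖kernel 𝕜 a (k + 1 + m₀) (Fin.append X X₀)‖ with hKa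
  set Kb : (Fin (k + 1) → P × S) → (Fin m₁ → P × S) → ℝ := fun Y Y₁ => ‖kernel 𝕜 b (k + 1 + m₁) (Fin.append Y Y₁)‖ with hKb
  set F : ℝ := ((k + 1 + m₀).factorial * (k + 1 + m₁).factorial : ℝ) / m.factorial with hF
  have hF0 : 0 ≤ F := by positivity
  -- termwise: the bridge
  have hterm : ∀ Z : Fin m → P × S,
      ‖kernel 𝕜 (((List.ofFn fun i => grassmannLaplacian 𝕜 (crossCov 𝕜 (C i))).reverse).prod
          (dblCopy 𝕜 0 a * dblCopy 𝕜 1 b)) m (fun i => (Z i, s i))‖ ≤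
        F * ∑ X : Fin (k + 1) → P × S, ∑ Y : Fin (k + 1) → P × S, (∏ i, ‖contr 𝕜 (C i) (X i) (Y i)‖) *
          Ka X (fun j => Z (ε (Sum.inl j))) * Kb Y (fun j => Z (ε (Sum.inr j))) := by
    intro Z
    have hb := norm_kernel_crossContract_le C a b (fun i => (Z i, s i)) h σ (fun j => Z (ε (Sum.inl j)))
      (fun j => Z (ε (Sum.inr j))) (hZ Z)
    refine hb.trans (le_of_eq ?_)
    simp only [hF, hKa, hKb, mul_assoc]
  refine (sum_le_sum fun Z _ => hterm Z).trans ?_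
  rw [← mul_sum]
  refine mul_le_mul_of_nonneg_left ?_ hF0
  rw [sum_filter_comp_sumEquiv_inl ε (fun X₀ Y₁ => ∑ X : Fin (k + 1) → P × S, ∑ Y : Fin (k + 1) → P × S,
    (∏ i, ‖contr 𝕜 (C i) (X i) (Y i)‖) * Ka X X₀ * Kb Y Y₁) p₀ z]
  exact sum_crossContraction_le Ka Kb (fun X Z => norm_nonneg _) (fun Y Z => norm_nonneg _)
    (fun i X Y => ‖contr 𝕜 (C i) X Y‖) (fun i X Y => norm_nonneg _) hc D hD d r hd hLD hr p₀ z hNb0 (hNa p₀) hNb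

/-- **The same, pinned at a free leg of `b`** (a pinned output leg of colour `1`): line `0` again through the row sums of its two-point function
(they equal its column sums by antisymmetry), `a` read with its line-`0` leg and the sectors of its other contracted legs fixed (`Na`), `b` in the
norm pinned at a free leg (`Nb`, any pinned position). -/
theorem sum_norm_kernel_crossContract_le_of_eq_one {k m m₀ m₁ : ℕ} (C : Fin (k + 1) → Matrix (P × S) (P × S) 𝕜)
    (a b : GrassmannAlgebra 𝕜 (P × S)) (s : Fin m → Fin 2) (hm₀ : (univ.filter fun i => s i = 0).card = m₀)
    (hm₁ : (univ.filter fun i => s i = 1).card = m₁) (p : Fin m) (hp : s p = 1) (z : P × S)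
    {c : ℝ} (hc : ∀ X, ∑ Y, ‖contr 𝕜 (C 0) X Y‖ ≤ c)
    (D : Fin k → S → S → ℝ) (hD : ∀ i σ τ, 0 ≤ D i σ τ) (d r : Fin k → ℝ) (hd : ∀ i, 0 ≤ d i)
    (hLD : ∀ (i : Fin k) (X Y : P × S), ‖contr 𝕜 (C i.succ) X Y‖ ≤ d i * D i X.2 Y.2) (hr : ∀ i τ, ∑ σ, D i σ τ ≤ r i)
    {Na Nb : ℝ} (hNa0 : 0 ≤ Na)
    (hNa : ∀ (X₀ : P × S) (σ : Fin k → S), ∑ x : Fin k → P, ∑ Z₀ : Fin m₀ → P × S,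
      ‖kernel 𝕜 a (k + 1 + m₀) (Fin.append (Fin.cons X₀ (fun i => (x i, σ i)) : Fin (k + 1) → P × S) Z₀)‖ ≤ Na)
    (hNb : ∀ p₁ : Fin m₁, ∑ Y : Fin (k + 1) → P × S, ∑ Y₁ ∈ univ.filter (fun Y₁ : Fin m₁ → P × S => Y₁ p₁ = z),
      ‖kernel 𝕜 b (k + 1 + m₁) (Fin.append Y Y₁)‖ ≤ Nb) :
    ∑ Z ∈ univ.filter (fun Z : Fin m → P × S => Z p = z),
        ‖kernel 𝕜 (((List.ofFn fun i => grassmannLaplacian 𝕜 (crossCov 𝕜 (C i))).reverse).prod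
          (dblCopy 𝕜 0 a * dblCopy 𝕜 1 b)) m (fun i => (Z i, s i))‖ ≤
      (((k + 1 + m₀).factorial * (k + 1 + m₁).factorial : ℝ) / m.factorial) * (c * (∏ i, d i * r i) * Na * Nb) := by
  classical
  obtain ⟨h, σ, ε, h0, h1, hZ⟩ := exists_colouring_equiv (Γ := P × S) s hm₀ hm₁
  -- the pinned leg is a one of the colouring: `p = ε (inr p₁)`
  obtain ⟨p₁, hp₁⟩ : ∃ p₁ : Fin m₁, ε (Sum.inr p₁) = p := by
    rcases hq : ε.symm p with j | p₁
    · exfalso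
      have := h0 j
      rw [← hq, Equiv.apply_symm_apply, hp] at this
      exact absurd this (by decide)
    · exact ⟨p₁, by rw [← hq, Equiv.apply_symm_apply]⟩
  subst hp₁
  set Ka : (Fin (k + 1) → P × S) → (Fin m₀ → P × S) → ℝ := fun X X₀ => ‖kernel 𝕜 a (k + 1 + m₀) (Fin.append X X₀)‖ with hKa
  set Kb : (Fin (k + 1) → P × S) → (Fin m₁ → P × S) → ℝ := fun Y Y₁ => ‖kernel 𝕜 b (k + 1 + m₁) (Fin.append Y Y₁)‖ with hKb
  set F : ℝ := ((k + 1 + m₀).factorial * (k + 1 + m₁).factorial : ℝ) / m.factorial with hF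
  have hF0 : 0 ≤ F := by positivity
  have hterm : ∀ Z : Fin m → P × S,
      ‖kernel 𝕜 (((List.ofFn fun i => grassmannLaplacian 𝕜 (crossCov 𝕜 (C i))).reverse).prod
          (dblCopy 𝕜 0 a * dblCopy 𝕜 1 b)) m (fun i => (Z i, s i))‖ ≤
        F * ∑ X : Fin (k + 1) → P × S, ∑ Y : Fin (k + 1) → P × S, (∏ i, ‖contr 𝕜 (C i) (X i) (Y i)‖) *
          Ka X (fun j => Z (ε (Sum.inl j))) * Kb Y (fun j => Z (ε (Sum.inr j))) := by
    intro Z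
    have hb := norm_kernel_crossContract_le C a b (fun i => (Z i, s i)) h σ (fun j => Z (ε (Sum.inl j)))
      (fun j => Z (ε (Sum.inr j))) (hZ Z)
    refine hb.trans (le_of_eq ?_)
    simp only [hF, hKa, hKb, mul_assoc]
  refine (sum_le_sum fun Z _ => hterm Z).trans ?_
  rw [← mul_sum]
  refine mul_le_mul_of_nonneg_left ?_ hF0
  rw [sum_filter_comp_sumEquiv_inr ε (fun X₀ Y₁ => ∑ X : Fin (k + 1) → P × S, ∑ Y : Fin (k + 1) → P × S,
    (∏ i, ‖contr 𝕜 (C i) (X i) (Y i)‖) * Ka X X₀ * Kb Y Y₁) p₁ z]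
  -- column sums of line `0` are its row sums
  have hc' : ∀ Y, ∑ X, ‖contr 𝕜 (C 0) X Y‖ ≤ c := fun Y => by
    simp_rw [norm_contr_swap (C 0) Y]; exact hc Y
  exact sum_crossContraction_le_symm Ka Kb (fun X Z => norm_nonneg _) (fun Y Z => norm_nonneg _)
    (fun i X Y => ‖contr 𝕜 (C i) X Y‖) (fun i X Y => norm_nonneg _) hc' D hD d r hd hLD hr p₁ z hNa0 hNa (hNb p₁)

omit [Fintype S] [DecidableEq P] [DecidableEq S] in
/-- Summing the colourings bounds the folded kernel on any set of output tuples: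
`Σ_{Z ∈ A} ‖kernel (dblFold F) m Z‖ ≤ Σ_s Σ_{Z ∈ A} ‖kernel F m (Z, s)‖`. -/
theorem sum_norm_kernel_dblFold_le {Γ : Type*} [Fintype Γ] [DecidableEq Γ] (F : GrassmannAlgebra 𝕜 (Γ × Fin 2)) (m : ℕ)
    (A : Finset (Fin m → Γ)) :
    ∑ Z ∈ A, ‖kernel 𝕜 (dblFold 𝕜 F) m Z‖ ≤ ∑ s : Fin m → Fin 2, ∑ Z ∈ A, ‖kernel 𝕜 F m (fun i => (Z i, s i))‖ := by
  rw [sum_comm]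
  exact sum_le_sum fun Z _ => norm_kernel_dblFold_le F m Z

end Glue

end Summit.HubbardSuperconductivity.HubbardSuperconductivity.Theorems.KLRegimeWick
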